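import Literature.NumberTheory.DiophantineGeometry.KroneckerHeightZero
import HarnessLib

/-!
# Freshness of `p`-th roots under the power maps `x ↦ x^p` (support for covering arguments)

E. Bombieri, W. Gubler, *Heights in Diophantine Geometry* (2006), §1.5: Kronecker's theorem 1.5.9 and
`h(α^λ) = |λ| h(α)` (Lemma 1.5.18) [cite: BombieriGubler2006, Thm 1.5.9]. This file packages their
consequence for the PREIMAGES of a finite set under the power maps `γ_p : x ↦ x^p` with varying
exponent — the "fresh roots" input of the slot-pigeonhole COVERING LEMMA of the `ℙ¹`-menu route to
[GenEll] Thm 2.1 (ii) ⇒ (i) (support item GenEllTwo; design note GENELLTWO-P1ROUTE §4, abc-iut-S6):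
away from torsion, a common point `z` of `γ_p⁻¹(a)` and `γ_q⁻¹(b)` (`p ≠ q`) forces the height relation
`q·h(a) = p·h(b)`, which for `a, b` of positive height is satisfied by AT MOST ONE pair of distinct
primes `(p, q)`; and `γ_p⁻¹(a) ∩ γ_q⁻¹(a) = ∅` unless `a` is torsion. So, for a finite set `X` of
non-torsion elements, the sets `γ_p⁻¹(X)`, `p` prime, are pairwise disjoint after discarding at most one
prime pair per ordered pair of elements of `X`.

* `primePair_eq_of_mul_eq_mul` (private) — arithmetic: `q p' = q' p` for primes `p ≠ q`, `p'` forces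
  `(p, q) = (p', q')`;
* `not_exists_common_root_self` — `a ≠ 0` non-torsion, `p ≠ q` ⟹ no `z` with `z^p = a = z^q`;
* `not_exists_common_root_of_isOfFinOrder_left` — `a` torsion, `b ≠ 0` non-torsion ⟹ no common root;
* `primePair_unique_of_ratio` (real-number bookkeeping), `primePair_unique_of_common_roots`,
  `not_exists_common_root_of_ne_pair` — `a, b ≠ 0` non-torsion:
  if `(p, q)` (distinct primes) and `(p', q')` (`p'` prime) each admit a common root
  (`z^p = a ∧ z^q = b`), then `(p, q) = (p', q')`.

All statements are about elements of a number field `K` (take `K` large enough to contain the roots in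
question); Mathlib-only apart from `KroneckerHeightZero`. Nothing here bears on anything disputed.
-/

namespace Literature.NumberTheory.DiophantineGeometry

open NumberField Height

variable {K : Type*} [Field K] [NumberField K]

/-- Arithmetic of prime pairs: if `p ≠ q` and `p'` are primes and `q · p' = q' · p`, then `p = p'` and
`q = q'` (the fraction `q/p` of distinct primes is in lowest terms). [folklore] -/
private theorem primePair_eq_of_mul_eq_mul {p q p' q' : ℕ} (hp : p.Prime) (hq : q.Prime)
    (hp' : p'.Prime) (hpq : p ≠ q) (h : q * p' = q' * p) :
    p = p' ∧ q = q' := by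
  -- `p ∣ q * p'` and `p ∤ q` (distinct primes) give `p ∣ p'`, hence `p = p'`.
  have hdvd : p ∣ q * p' := ⟨q', by rw [h, mul_comm]⟩
  have hpp' : p = p' := by
    rcases (Nat.Prime.dvd_mul hp).1 hdvd with h1 | h1
    · exact absurd ((Nat.prime_dvd_prime_iff_eq hp hq).1 h1) hpq
    · exact (Nat.prime_dvd_prime_iff_eq hp hp').1 h1
  subst hpp'
  refine ⟨rfl, ?_⟩
  have := mul_right_cancel₀ hp.ne_zero h
  exact this

omit [NumberField K] in
/-- No element of positive height has a common `p`-th and `q`-th root for `p ≠ q`: if `z ^ p = a = z ^ q`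
with `p ≠ q` and `a ≠ 0` then `a` is a root of unity (Kronecker's theorem is not even needed — pure
algebra, `isOfFinOrder_of_pow_eq_of_pow_eq`); stated here in the contrapositive form used by the covering
lemma. [cite: BombieriGubler2006, Thm 1.5.9] -/
theorem not_exists_common_root_self {a : K} (ha : a ≠ 0) (hat : ¬ IsOfFinOrder a) {p q : ℕ}
    (hpq : p ≠ q) : ¬ ∃ z : K, z ^ p = a ∧ z ^ q = a :=
  fun ⟨_, hp, hq⟩ => hat (isOfFinOrder_of_pow_eq_of_pow_eq ha hpq hp hq)

omit [NumberField K] in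
/-- A torsion point and a point of positive height have no common root: if `a` is a root of unity,
`b ≠ 0` is not, and `0 < p`, then there is no `z` with `z ^ p = a` and `z ^ q = b` (such a `z` would be
torsion, hence so would `b`). [cite: BombieriGubler2006, Thm 1.5.9] -/
theorem not_exists_common_root_of_isOfFinOrder_left {a b : K} (hat : IsOfFinOrder a)
    (hbt : ¬ IsOfFinOrder b) {p q : ℕ} (hp : 0 < p) :
    ¬ ∃ z : K, z ^ p = a ∧ z ^ q = b := by
  rintro ⟨z, hza, hzb⟩
  apply hbt
  rw [← hzb]
  have hz : IsOfFinOrder z := by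
    rw [isOfFinOrder_iff_pow_eq_one] at hat ⊢
    obtain ⟨n, hn, han⟩ := hat
    exact ⟨p * n, Nat.mul_pos hp hn, by rw [pow_mul, hza, han]⟩
  exact hz.pow

/-- Exponent bookkeeping: if `hA, hB ≠ 0` are reals (heights) with `q·hA = p·hB` and `q'·hA = p'·hB` for
primes `p ≠ q` and `p'`, then `p = p'` and `q = q'` — the ratio `q : p` in lowest terms is determined by
`hB / hA`. [cite: BombieriGubler2006, Lemma 1.5.18] -/
theorem primePair_unique_of_ratio {hA hB : ℝ} (hA0 : hA ≠ 0) (hB0 : hB ≠ 0) {p q p' q' : ℕ}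
    (hp : p.Prime) (hq : q.Prime) (hp' : p'.Prime) (hpq : p ≠ q) (h1 : (q : ℝ) * hA = p * hB)
    (h2 : (q' : ℝ) * hA = p' * hB) : p = p' ∧ q = q' := by
  have h3 : ((q * p' : ℕ) : ℝ) * (hA * hB) = ((q' * p : ℕ) : ℝ) * (hA * hB) := by
    push_cast
    calc (q : ℝ) * p' * (hA * hB) = (q * hA) * (p' * hB) := by ring
      _ = (p * hB) * (q' * hA) := by rw [h1, ← h2]
      _ = (q' : ℝ) * p * (hA * hB) := by ring
  have h4 : ((q * p' : ℕ) : ℝ) = ((q' * p : ℕ) : ℝ) := mul_right_cancel₀ (mul_ne_zero hA0 hB0) h3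
  exact primePair_eq_of_mul_eq_mul hp hq hp' hpq (by exact_mod_cast h4)

/-- The height relation forced by a common root, solved for the exponent ratio: if `a, b` have POSITIVE
height and `z ^ p = a`, `z ^ q = b`, then `q · h(a) = p · h(b)` (`mul_logHeight₁_eq_of_pow_eq`), so the
ratio `q : p` is determined by `(a, b)`. Consequently, among pairs `(p, q)` of DISTINCT PRIMES at most one
admits a common root: if `(p, q)` does and `(p', q')` with `p'` prime does too, then `p = p'` and `q = q'`.
(Kronecker's theorem 1.5.9 says "positive height" = "nonzero and not a root of unity".)
[cite: BombieriGubler2006, Lemma 1.5.18] -/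
theorem primePair_unique_of_common_roots {a b : K} (ha : a ≠ 0) (hat : ¬ IsOfFinOrder a) (hb : b ≠ 0)
    (hbt : ¬ IsOfFinOrder b) {p q p' q' : ℕ} (hp : p.Prime) (hq : q.Prime) (hp' : p'.Prime)
    (hpq : p ≠ q) {z z' : K} (hza : z ^ p = a) (hzb : z ^ q = b)
    (hz'a : z' ^ p' = a) (hz'b : z' ^ q' = b) : p = p' ∧ q = q' :=
  primePair_unique_of_ratio ((logHeight₁_pos_iff a).2 ⟨ha, hat⟩).ne' ((logHeight₁_pos_iff b).2 ⟨hb, hbt⟩).ne'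
    hp hq hp' hpq (mul_logHeight₁_eq_of_pow_eq hza hzb) (mul_logHeight₁_eq_of_pow_eq hz'a hz'b)

/-- Disjointness form: for `a, b ≠ 0` of positive height and two DIFFERENT pairs of distinct primes
`(p, q) ≠ (p', q')` (`p'` prime), the preimages cannot both meet — if `x^p = a, x^q = b` has a solution
then `x^{p'} = a, x^{q'} = b` has none. [cite: BombieriGubler2006, Lemma 1.5.18] -/
theorem not_exists_common_root_of_ne_pair {a b : K} (ha : a ≠ 0) (hat : ¬ IsOfFinOrder a) (hb : b ≠ 0)
    (hbt : ¬ IsOfFinOrder b) {p q p' q' : ℕ} (hp : p.Prime) (hq : q.Prime) (hp' : p'.Prime)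
    (hpq : p ≠ q) (hne : (p, q) ≠ (p', q'))
    (h : ∃ z : K, z ^ p = a ∧ z ^ q = b) : ¬ ∃ z' : K, z' ^ p' = a ∧ z' ^ q' = b := by
  rintro ⟨z', hz'a, hz'b⟩
  obtain ⟨z, hza, hzb⟩ := h
  obtain ⟨rfl, rfl⟩ :=
    primePair_unique_of_common_roots ha hat hb hbt hp hq hp' hpq hza hzb hz'a hz'b
  exact hne rfl

/-! ### The torsion regime: exponents `≡ 1 (mod O)` fix the `O`-torsion pointwise

For the torsion points of `X` the menu uses prime exponents `p ≡ 1 (mod O)`, `O` a common multiple of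
the orders met; then `ζ ↦ ζ^p` FIXES every `O`-torsion `ζ`, and two such exponents `p, q` with
`gcd(p, q) = 1` have torsion preimages meeting only in the fixed points themselves. -/

/-- If `z ^ p = ζ` and `z ^ q = ζ'` with `ζ ^ O = ζ' ^ O = 1`, `p ≡ q ≡ 1 (mod O)` and `gcd(p, q) = 1`, then
`z = ζ = ζ'`: the order of `z` divides `gcd(pO, qO) = O`, so `z ^ p = z = z ^ q`. (Torsion regime of the
"fresh roots" bookkeeping: preimages of torsion points under two menu exponents meet only in points
fixed by the family.) [cite: BombieriGubler2006, Thm 1.5.9] -/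
theorem eq_of_pow_eq_torsion_of_modEq_one {G : Type*} [Monoid G] {z ζ ζ' : G} {O p q : ℕ}
    (hζ : ζ ^ O = 1) (hζ' : ζ' ^ O = 1) (hp : p ≡ 1 [MOD O]) (hq : q ≡ 1 [MOD O])
    (hcop : Nat.Coprime p q) (hzp : z ^ p = ζ) (hzq : z ^ q = ζ') : z = ζ ∧ z = ζ' := by
  -- the order of `z` divides `p * O` and `q * O`, hence their gcd `O`
  have h1 : orderOf z ∣ p * O := orderOf_dvd_of_pow_eq_one (by rw [pow_mul, hzp, hζ])
  have h2 : orderOf z ∣ q * O := orderOf_dvd_of_pow_eq_one (by rw [pow_mul, hzq, hζ'])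
  have hO : orderOf z ∣ O := by
    have := Nat.dvd_gcd h1 h2
    rwa [Nat.gcd_mul_right, hcop, one_mul] at this
  have hzO : z ^ O = 1 := orderOf_dvd_iff_pow_eq_one.1 hO
  -- `p ≡ 1 (mod O)` ⟹ `z ^ p = z`, and likewise for `q`
  have key : ∀ {n : ℕ}, n ≡ 1 [MOD O] → z ^ n = z := by
    intro n hn
    calc z ^ n = z ^ (n % O + O * (n / O)) := by rw [Nat.mod_add_div]
      _ = z ^ (n % O) * (z ^ O) ^ (n / O) := by rw [pow_add, pow_mul]
      _ = z ^ (1 % O) := by rw [hzO, one_pow, mul_one, hn]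
      _ = z := by
        rcases Nat.lt_or_ge 1 O with hO1 | hO1
        · rw [Nat.mod_eq_of_lt hO1, pow_one]
        · -- `O ≤ 1`: then `z ^ O = 1` forces `z = 1` (O = 1) or is vacuous bookkeeping (O = 0)
          interval_cases O
          · simp at hzO ⊢  -- O = 0: `1 % 0 = 1`
          · rw [pow_one] at hzO
            simp [hzO]
  exact ⟨by rw [← hzp, key hp], by rw [← hzq, key hq]⟩

/-! ### The same over any field of characteristic zero (e.g. `ℂ`, `ℚ̄_p`), for algebraic `a`, `b`

The conclusions above do not mention heights, so they transfer to algebraic elements of an arbitrary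
field `L` of characteristic zero by passing to the number field `ℚ(a, b, z, z') ⊆ L`. This is the form in
which a covering argument over the complex (or `2`-adic) conjugates of a point consumes them. -/

section CharZero

variable {L : Type*} [Field L] [CharZero L]

/-- Finite order is detected inside any intermediate field. [folklore] -/
private theorem isOfFinOrder_coe_iff (E : IntermediateField ℚ L) (x : E) :
    IsOfFinOrder (x : L) ↔ IsOfFinOrder x := by
  rw [isOfFinOrder_iff_pow_eq_one, isOfFinOrder_iff_pow_eq_one]
  constructor
  · rintro ⟨n, hn, h⟩
    exact ⟨n, hn, Subtype.ext (by exact_mod_cast h)⟩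
  · rintro ⟨n, hn, h⟩
    exact ⟨n, hn, by exact_mod_cast congrArg Subtype.val h⟩

/-- `primePair_unique_of_common_roots` for algebraic elements of any field of characteristic zero: if
`a, b ≠ 0` are algebraic over `ℚ` and not roots of unity, `(p, q)` are distinct primes, `p'` is prime, and
`z ^ p = a`, `z ^ q = b`, `z' ^ p' = a`, `z' ^ q' = b`, then `p = p'` and `q = q'`. (Proof: everything lives
in the number field `ℚ(a, b, z, z')`.) [cite: BombieriGubler2006, Lemma 1.5.18] -/
theorem primePair_unique_of_common_roots_of_isAlgebraic {a b : L} (ha : a ≠ 0) (hat : ¬ IsOfFinOrder a)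
    (hb : b ≠ 0) (hbt : ¬ IsOfFinOrder b) (haQ : IsAlgebraic ℚ a) (hbQ : IsAlgebraic ℚ b)
    {p q p' q' : ℕ} (hp : p.Prime) (hq : q.Prime) (hp' : p'.Prime) (hpq : p ≠ q) {z z' : L}
    (hza : z ^ p = a) (hzb : z ^ q = b) (hz'a : z' ^ p' = a) (hz'b : z' ^ q' = b) :
    p = p' ∧ q = q' := by
  -- `z`, `z'` are algebraic too
  have hzQ : IsAlgebraic ℚ z := IsAlgebraic.of_pow hp.pos (hza ▸ haQ)
  have hz'Q : IsAlgebraic ℚ z' := IsAlgebraic.of_pow hp'.pos (hz'a ▸ haQ)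
  -- the number field `E = ℚ(a, b, z, z')`
  set S : Set L := {a, b, z, z'} with hS
  set E : IntermediateField ℚ L := IntermediateField.adjoin ℚ S with hE
  have hfin : FiniteDimensional ℚ E := by
    refine IntermediateField.finiteDimensional_adjoin fun x hx => ?_
    simp only [hS, Set.mem_insert_iff, Set.mem_singleton_iff] at hx
    rcases hx with rfl | rfl | rfl | rfl
    · exact haQ.isIntegral
    · exact hbQ.isIntegral
    · exact hzQ.isIntegral
    · exact hz'Q.isIntegral
  haveI : NumberField E := @NumberField.mk E _ inferInstance hfin
  have hsub : S ⊆ (E : Set L) := IntermediateField.subset_adjoin ℚ S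
  have haE : a ∈ E := hsub (by simp [hS])
  have hbE : b ∈ E := hsub (by simp [hS])
  have hzE : z ∈ E := hsub (by simp [hS])
  have hz'E : z' ∈ E := hsub (by simp [hS])
  -- transport everything into `E`
  have hzaE : (⟨z, hzE⟩ : E) ^ p = ⟨a, haE⟩ := Subtype.ext (by push_cast; exact hza)
  have hzbE : (⟨z, hzE⟩ : E) ^ q = ⟨b, hbE⟩ := Subtype.ext (by push_cast; exact hzb)
  have hz'aE : (⟨z', hz'E⟩ : E) ^ p' = ⟨a, haE⟩ := Subtype.ext (by push_cast; exact hz'a)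
  have hz'bE : (⟨z', hz'E⟩ : E) ^ q' = ⟨b, hbE⟩ := Subtype.ext (by push_cast; exact hz'b)
  have haE0 : (⟨a, haE⟩ : E) ≠ 0 := fun h => ha (congrArg Subtype.val h)
  have hbE0 : (⟨b, hbE⟩ : E) ≠ 0 := fun h => hb (congrArg Subtype.val h)
  have hatE : ¬ IsOfFinOrder (⟨a, haE⟩ : E) := fun h => hat ((isOfFinOrder_coe_iff E ⟨a, haE⟩).2 h)
  have hbtE : ¬ IsOfFinOrder (⟨b, hbE⟩ : E) := fun h => hbt ((isOfFinOrder_coe_iff E ⟨b, hbE⟩).2 h)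
  exact primePair_unique_of_common_roots haE0 hatE hbE0 hbtE hp hq hp' hpq hzaE hzbE hz'aE hz'bE

/-- Contrapositive/disjointness form over any characteristic-zero field: for algebraic `a, b ≠ 0` of
infinite order and different pairs `(p, q) ≠ (p', q')` (`p ≠ q`, all of `p, q, p'` prime), a common root for
`(p, q)` excludes a common root for `(p', q')`. [cite: BombieriGubler2006, Lemma 1.5.18] -/
theorem not_exists_common_root_of_ne_pair_of_isAlgebraic {a b : L} (ha : a ≠ 0) (hat : ¬ IsOfFinOrder a)
    (hb : b ≠ 0) (hbt : ¬ IsOfFinOrder b) (haQ : IsAlgebraic ℚ a) (hbQ : IsAlgebraic ℚ b)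
    {p q p' q' : ℕ} (hp : p.Prime) (hq : q.Prime) (hp' : p'.Prime) (hpq : p ≠ q)
    (hne : (p, q) ≠ (p', q')) (h : ∃ z : L, z ^ p = a ∧ z ^ q = b) :
    ¬ ∃ z' : L, z' ^ p' = a ∧ z' ^ q' = b := by
  rintro ⟨z', hz'a, hz'b⟩
  obtain ⟨z, hza, hzb⟩ := h
  obtain ⟨rfl, rfl⟩ := primePair_unique_of_common_roots_of_isAlgebraic ha hat hb hbt haQ hbQ hp hq hp'
    hpq hza hzb hz'a hz'b
  exact hne rfl

/-! ### Packaged form: a finite exceptional set of prime pairs -/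

/-- **Freshness, packaged for the covering lemma.** Let `A` be a finite set of nonzero algebraic elements
of infinite order (positive height) in a field of characteristic zero. There is a finite set `Bad` of
pairs of naturals, `#Bad ≤ #A · #A`, such that for all primes `p ≠ q` with `(p, q) ∉ Bad` NO `z` has both
`z ^ p ∈ A` and `z ^ q ∈ A` — i.e. the preimages of `A` under `x ↦ x^p` and `x ↦ x^q` are disjoint.
(`Bad` collects, for each ordered pair `(a, b) ∈ A × A`, the at most one prime pair admitting a common
root, `primePair_unique_of_common_roots_of_isAlgebraic`.) [cite: BombieriGubler2006, Lemma 1.5.18] -/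
theorem exists_badPairs_pow_preimages_disjoint {L : Type*} [Field L] [CharZero L] (A : Finset L)
    (hA0 : ∀ a ∈ A, a ≠ 0) (hAt : ∀ a ∈ A, ¬ IsOfFinOrder a) (hAQ : ∀ a ∈ A, IsAlgebraic ℚ a) :
    ∃ Bad : Finset (ℕ × ℕ), Bad.card ≤ A.card * A.card ∧
      ∀ p q : ℕ, p.Prime → q.Prime → p ≠ q → (p, q) ∉ Bad →
        ∀ z : L, z ^ p ∈ A → z ^ q ∈ A → False := by
  classical
  -- for each ordered pair `(a, b)` the (at most one) prime pair with a common root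
  let W : L × L → Prop := fun ab =>
    ∃ pq : ℕ × ℕ, pq.1.Prime ∧ pq.2.Prime ∧ pq.1 ≠ pq.2 ∧ ∃ z : L, z ^ pq.1 = ab.1 ∧ z ^ pq.2 = ab.2
  let pick : L × L → Finset (ℕ × ℕ) := fun ab => if h : W ab then {h.choose} else ∅
  refine ⟨(A ×ˢ A).biUnion pick, ?_, ?_⟩
  · calc ((A ×ˢ A).biUnion pick).card ≤ ∑ ab ∈ A ×ˢ A, (pick ab).card := Finset.card_biUnion_le
      _ ≤ ∑ _ab ∈ A ×ˢ A, 1 := Finset.sum_le_sum fun ab _ => by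
          simp only [pick]
          split_ifs <;> simp
      _ = A.card * A.card := by simp [Finset.card_product]
  · intro p q hp hq hpq hnot z hzp hzq
    have hW : W (z ^ p, z ^ q) := ⟨(p, q), hp, hq, hpq, z, rfl, rfl⟩
    -- the chosen pair for `(z^p, z^q)` must be `(p, q)` by uniqueness
    obtain ⟨hp', hq', hpq', z', hz'1, hz'2⟩ := hW.choose_spec
    have huniq := primePair_unique_of_common_roots_of_isAlgebraic (L := L)
      (hA0 _ hzp) (hAt _ hzp) (hA0 _ hzq) (hAt _ hzq) (hAQ _ hzp) (hAQ _ hzq)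
      hp hq hp' hpq (z := z) (z' := z') rfl rfl hz'1 hz'2
    apply hnot
    refine Finset.mem_biUnion.2 ⟨(z ^ p, z ^ q), Finset.mem_product.2 ⟨hzp, hzq⟩, ?_⟩
    simp only [pick, dif_pos hW, Finset.mem_singleton]
    exact Prod.ext huniq.1 huniq.2

end CharZero

end Literature.NumberTheory.DiophantineGeometry
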